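import Literature.AlgebraicGeometry.AbelianSchemes.MFKIntrinsicOfLinearRigidification
import Literature.AlgebraicGeometry.ModuliOfAbelianVarieties.SiegelLinearRigidificationHilbertPolynomial
import Literature.AlgebraicGeometry.Modules.ProjectionFormulaLocallyFree
import Literature.AlgebraicGeometry.Modules.TensorBraiding
import Literature.AlgebraicGeometry.Motives.GrassmannianQuotientIsoPullback
import Literature.AlgebraicGeometry.Motives.GrassmannianUniversalSubbundle
import HarnessLib

/-!
# The frame classes of a linear rigidification, `[U]`-free: `π_*𝒪_X(1)` is free, and the `(m+1)`-th powers of the marked-point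
# and twist classes are products of `[σ^*L^Δ(λ)]`, `[det π_*L^Δ(λ)^{⊗3}]`, `[det π_*L^Δ(λ)^{⊗3d}]`

Layer `Literature/AlgebraicGeometry/ModuliOfAbelianVarieties` (sibling of ★ `SiegelLinearRigidificationHilbertPolynomial`), namespace
`Literature.AlgebraicGeometry.AbelianSchemes.PolarizedAbelianSchemeWithLevel`.  THEOREMS ONLY (no definition, no named fact, no instance, no notation, no `sorry`).  Cell `hodgecm-mathlib` (D-0151), floor-0 programme P1,
sub-line F-13 `Lines/F13PluckerProducer` (shape (β′)), stub P3 `stub_PLunitCocycle` (BRIEF C; B-p11 (g20)): the HEAD `IsLinearRigidification.frameClasses`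
is that stub's letter with the `2g+1` marked sections `P.markedSection a` replaced by an arbitrary section `σ` of `π` (so that this file imports
only landed modules; the stub follows by a three-line specialisation).  Count-neutral capital: HC_CM is proved only modulo the 7 printed
citations until rung 0 closes — nothing here bears on a summit statement.

SETTING ([MumfordFogartyKirwan1994] Ch. 7 §2).  A triple `P = (X/T, λ, σ)` (★ `PolarizedAbelianSchemeWithLevel`) over a locally Noetherian
`ℚ`-scheme `T`, a ★ (8α) LINEAR RIGIDIFICATION `ι : X → 𝐏^J_ℤ` (Def. 7.5: Zariski-locally on `T` the morphism of a frame of `π_*L^Δ(λ)^{⊗3}`) with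
`#J + 1 = 6^g·d_δ` (the rank of `π_*L^Δ(λ)^{⊗3}`, Prop. 6.13), and the graph datum `Gr = (1, λ)` (`L^Δ(λ) = Gr^*𝒫`).  Prop. 7.4 (p. 135)
reads the covariant `H` inside `(𝐏_m)^{2g+1} × Hilb` through the classes of the marked points `σₐ ≫ ι` and of the twists `π_*𝒪_X(d)`; the
linear rigidification differs from `L^{Δ3}` by a unit cocycle `[U]` of the base (B-p10 (c1)–(c3): `(m+1)[U] = [det π_*L^{Δ3}]`,
`[(σₐ ≫ ι)^*𝒪(1)] = 3[σₐ^*L^Δ] − [U]`, `[det π_*𝒪_X(d)] = [det π_*L^{Δ3d}] − d·r_d·[U]`).  This file proves the `(m+1)`-th-power identities in which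
`[U]` is ELIMINATED, without constructing the cocycle: `[U]` is replaced by the class `ν_ε = [(ε ≫ ι)^*𝒪(-1)]` through clause (V) of Prop. 7.3
(★ R-B2a `nonempty_normalised_iso_LDelta_tensorPow_of_isLinearRigidification`: `𝒪_X(1) ⊗ π^*(ε^*𝒪_X(1))^∨ ≅ L^Δ(λ)^{⊗3}`), and `(m+1)·ν_ε` is
computed from step (VI) of Prop. 7.3 run over the base `T` itself: `π_*𝒪_X(1)` is FREE on the coordinate sections.

* §1 **`IsLinearRigidification.exists_isIso_freeModule_hom_pushforward_twistMod_one`** — `u : 𝒪_T^{6^g·d} ⥲ π_*𝒪_X(1)`, `ε_k ↦ x_{κ k}|_X`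
  (★ `MFKIntrinsicOfLinearRigidification` §0/§1 on each member of the rigidifying cover, ★ `isIso_pushforwardBaseChangeHom_of_isOpenImmersion`);
  `detClass_freeModule_eq_one`, `IsLinearRigidification.detClass_pushforward_twistMod_one_eq_one` (`[det π_*𝒪_X(1)] = 1`).
* §2 `detClass_twistMod_unitModule_eq_inv` (`[𝒪(m)] = [𝒪(-m)]⁻¹`), `cechPic_pullback_detClass_twistMod_one` (`σ^*[𝒪_X(1)] = ν_σ⁻¹`,
  ★ `isIso_pullbackTwistHom`), **`IsLinearRigidification.detClass_twistMod_one_mul_inv_eq_detClass_LDelta_pow`** (clause (V) in classes: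
  `[𝒪_X(1)]·(π^*ε^*[𝒪_X(1)])⁻¹ = [L^Δ]^3`), `IsLinearRigidification.detClass_serreTwist_section_inv_mul` (`ν_σ⁻¹·ν_ε = [σ^*L^Δ]^3` for a section `σ`),
  `detClass_dual_unitSection_pullback_twistMod_one` (`[(ε^*𝒪_X(1))^∨] = ν_ε`).
* §3 **`IsLinearRigidification.exists_detClass_pushforward_LDelta_pow_three`** — `π_*L^{Δ3} ≅ (ε^*𝒪_X(1))^∨ ⊗ 𝒪_T^{6^g·d}` (★ `projectionFormulaIso`,
  ★ `tensorComm`, §1), hence finite locally free with `[det π_*L^{Δ3}] = ν_ε^{6^g·d}`.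
* §4 (c2′) `IsLinearRigidification.frameClass_section` — `ν_σ^{#J+1} = [σ^*L^Δ]^{-3(#J+1)} · [det π_*L^{Δ3}]`.
* §5 (c3′) `IsLinearRigidification.frameClass_pushforward_twistMod` — `[det π_*𝒪_X(d)]^{#J+1} = [det π_*L^{Δ3d}]^{#J+1} · [det π_*L^{Δ3}]^{-d·(6d)^g·d_δ}`
  (`d > 0`; rank `(6d)^g·d_δ` of `π_*𝒪_X(d)` by ★ `IsLinearRigidification.hasRank_pushforward_twistMod` — cohomology and base change —, `L^{Δ3d} ≅
  π^*((ε^*𝒪_X(1))^∨)^{⊗d} ⊗ 𝒪_X(d)` by ★ `nonempty_iso_iff_detClass_eq`, projection formula).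
* §6 HEAD **`IsLinearRigidification.frameClasses`** — (c2′) ∧ (c3′) in the binder order of the stub letter (`∃` local-freeness witnesses, `∃ e₁ e₂ : ℤ`).

## References
* [MumfordFogartyKirwan1994] D. Mumford, J. Fogarty, F. Kirwan, *Geometric Invariant Theory*, 3rd ed. (1994), Ch. 7 §2 Def. 7.5 (p. 130),
  Prop. 7.3 and its proof, steps (V)–(VI) (pp. 132–134), Prop. 7.4 (p. 135), Prop. 7.6 (p. 136), Def. 7.2 (p. 129); Ch. 6 §2 Prop. 6.13 (p. 123).
* [Hartshorne1977] R. Hartshorne, *Algebraic Geometry* (1977), II Prop. 5.12 (p. 117), II Ex. 5.1 (d), II Ex. 5.16, II Ex. 6.8, II Ex. 6.11,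
  III Ex. 4.5.
-/

noncomputable section

-- Mathlib's `Over`/pull-back API and `Scheme.Modules` section API are stated across semireducible wrappers (as in ★ R-B2a, ★ MFK R-B).
set_option backward.isDefEq.respectTransparency false

open CategoryTheory CategoryTheory.Limits AlgebraicGeometry MonoidalCategory Opposite TopologicalSpace
open Literature.AlgebraicGeometry.Modules Literature.AlgebraicGeometry.Modules.SerreTwist
open Literature.AlgebraicGeometry.Motives Literature.AlgebraicGeometry.Motives.GeneratingSections
open Literature.AlgebraicGeometry.Morphisms Literature.AlgebraicGeometry.Morphisms.ProjCech Literature.AlgebraicGeometry.AbelianVarieties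
open Literature.AlgebraicGeometry.ModuliOfAbelianVarieties

universe u


namespace Literature.AlgebraicGeometry.AbelianSchemes

namespace PolarizedAbelianSchemeWithLevel

variable {g N : ℕ} {δ : Fin g → ℕ} {J : Type} [Finite J] {T : Scheme.{0}}

/-! ## §1 The direct image of `𝒪_X(1)` along a linearly rigidified family is FREE on the coordinate sections -/

/-- **`π_*𝒪_X(1) ≅ 𝒪_T^{m+1}` for a linear rigidification** ([MumfordFogartyKirwan1994] Prop. 7.3 step (VI), with `H₀ := T`): for a
triple `P = (X/T, λ, σ)` over a locally Noetherian `T` and a ★ (8α) linear rigidification `ι : X → 𝐏^J_ℤ` with `#J + 1 = 6^g·d`, the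
morphism `u : 𝒪_T^{6^g·d} → π_*(twistMod ι 𝒪_X 1)` sending `ε_k` to the coordinate section `x_{κ k}|_X` is an ISOMORPHISM — on each
member of the rigidifying cover the framed `π_*L^Δ(λ)^{⊗3}` IS `π_*𝒪_X(1)` with basis sections `x_j|_X` (★ V-brick
`SerreTwist.exists_iso_twistMod_one_homEquiv_pointOfSections_app_eq`, ★ §1 of `MFKIntrinsicOfLinearRigidification`), base change of `π_*`
along the open immersion is an isomorphism (★ `isIso_pushforwardBaseChangeHom_of_isOpenImmersion`), and isomorphisms are Zariski-local
(★ `isIso_of_forall_isIso_pullback_map_openCover`).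
[cite: MumfordFogartyKirwan1994, Ch. 7 §2 Prop. 7.3, step (VI) of the proof (p. 134)] [cite: MumfordFogartyKirwan1994, Ch. 7 §2 Def. 7.5 (p. 130)] -/
theorem IsLinearRigidification.exists_isIso_freeModule_hom_pushforward_twistMod_one [IsLocallyNoetherian T]
    (P : PolarizedAbelianSchemeWithLevel g N δ T) {ι : P.A.X.left ⟶ projectiveSpaceInt J}
    (hι : P.IsLinearRigidification J ι) (hJ : Nat.card J + 1 = 6 ^ g * polarizationDegree δ) :
    ∃ u : freeModule T (Fin (6 ^ g * polarizationDegree δ)) ⟶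
        (Scheme.Modules.pushforward P.A.X.hom).obj (twistMod ι (unitModule P.A.X.left) 1),
      IsIso u ∧ ∀ (k : Fin (6 ^ g * polarizationDegree δ)) (V : T.Opens), u.app V (freeSectionOn T k V) =
        ((Scheme.Modules.pushforward P.A.X.hom).obj (twistMod ι (unitModule P.A.X.left) 1)).presheaf.map
          (homOfLE (le_top : V ≤ ⊤)).op (monomialSection ι 1 fun _ => finCongr hJ.symm k) := by
  set κ : Fin (6 ^ g * polarizationDegree δ) ≃ Fin (Nat.card J + 1) := finCongr hJ.symm
  obtain ⟨u, hu⟩ := exists_hom_freeModule_app_eq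
    ((Scheme.Modules.pushforward P.A.X.hom).obj (twistMod ι (unitModule P.A.X.left) 1))
    (fun k => (monomialSection ι 1 fun _ => κ k :))
  refine ⟨u, ?_, hu⟩
  obtain ⟨𝒰, h𝒰⟩ := id hι
  refine isIso_of_forall_isIso_pullback_map_openCover u 𝒰 fun i ↦ ?_
  have sqi : IsPullback (pullback.fst P.A.X.hom (𝒰.f i)) (P.baseChange (𝒰.f i)).A.X.hom P.A.X.hom (𝒰.f i) :=
    IsPullback.of_hasPullback _ _
  obtain ⟨Gr, hGr₁, hGr₂, F, h1, e, hcov, hEq⟩ := h𝒰 i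
  -- the framed `L^Δ(λ|_{Uᵢ})³` IS `𝒪(1)` for `pr_X ≫ ι`, with its coordinate sections (★ V-brick section clause)
  have key : ∀ (m : (P.baseChange (𝒰.f i)).A.X.left ⟶ projectiveSpaceInt J),
      projectiveSpace.homEquiv (Over.mk (P.baseChange (𝒰.f i)).A.X.hom)
        (projectiveSpace.pointOfSections (Over.mk (P.baseChange (𝒰.f i)).A.X.hom)
          (ofCocycleSections F.U (CocycleSections.ofFrameSystem F h1 fun j ↦ (basisSection e j :)) hcov)) = m →
      ∃ φ : tensorPow ((Scheme.Modules.pullback Gr).obj (P.baseChange (𝒰.f i)).D.P) 3 ≅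
          twistMod m (unitModule (P.baseChange (𝒰.f i)).A.X.left) 1,
        ∀ j, φ.hom.app ⊤ (basisSection e j :) = monomialSection m 1 fun _ : Fin 1 => j := by
    rintro m rfl
    exact SerreTwist.exists_iso_twistMod_one_homEquiv_pointOfSections_app_eq (J := J) _ F h1
      (fun j ↦ (basisSection e j :)) hcov
  obtain ⟨φ, hφ⟩ := key (pullback.fst P.A.X.hom (𝒰.f i) ≫ ι) hEq
  have h6 := isIso_pullback_map_comp_pushforwardBaseChangeHom_of_frame P.A.X.hom ι κ u hu (P.baseChange (𝒰.f i)).A.X.hom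
    (pullback.fst P.A.X.hom (𝒰.f i)) sqi.w e φ hφ
  haveI := isIso_pushforwardBaseChangeHom_of_isOpenImmersion sqi (twistMod ι (unitModule P.A.X.left) 1)
  exact IsIso.of_isIso_comp_right _ (pushforwardBaseChangeHom sqi.w (twistMod ι (unitModule P.A.X.left) 1))

/-- The free module `𝒪_T^{(I)}` has trivial determinant class: its global frame is a frame system with constant transition `1`.
[cite: Hartshorne1977, II Ex. 5.16] -/
theorem detClass_freeModule_eq_one {S : Scheme.{0}} {n : ℕ} (h : IsFiniteLocallyFree (freeModule S (Fin n))) :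
    detClass h = 1 := by
  let F : FrameSystem (freeModule S (Fin n)) :=
    { U := fun _ => ⊤, mem := fun _ => trivial, I := fun _ => Fin n, rank := fun _ => n,
      enum := fun _ => _root_.Equiv.refl _, frame := fun _ => freeModuleFrame S (Fin n) ⊤ }
  rw [detClass_eq_mk h F, ← CechPic.mk_one]
  refine CechPic.sound (UnitCocycle.equiv_of_eq _ _ (fun _ => ⊤) (fun _ => trivial) (fun _ => le_rfl) (fun _ => le_rfl)
    fun x y V hx hy => ?_)
  change (1 : Γ(S, V)) = transitionDet _ _ _ _ (homOfLE hx) (homOfLE hy)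
  rw [transitionDet_congr_hom _ _ _ _ (homOfLE hx) (homOfLE hy) (homOfLE hy) (homOfLE hy), transitionDet_self]

/-- **`[det π_*𝒪_X(1)] = 1` for a linear rigidification** (any local-freeness witness): `π_*𝒪_X(1)` is free (§1).
[cite: MumfordFogartyKirwan1994, Ch. 7 §2 Prop. 7.3, step (VI) of the proof (p. 134)] -/
theorem IsLinearRigidification.detClass_pushforward_twistMod_one_eq_one [IsLocallyNoetherian T]
    (P : PolarizedAbelianSchemeWithLevel g N δ T) {ι : P.A.X.left ⟶ projectiveSpaceInt J}
    (hι : P.IsLinearRigidification J ι) (hJ : Nat.card J + 1 = 6 ^ g * polarizationDegree δ)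
    (h : IsFiniteLocallyFree ((Scheme.Modules.pushforward P.A.X.hom).obj (twistMod ι (unitModule P.A.X.left) 1))) :
    detClass h = 1 := by
  obtain ⟨u, hu, -⟩ := hι.exists_isIso_freeModule_hom_pushforward_twistMod_one P hJ
  have hfree : IsFiniteLocallyFree (freeModule T (Fin (6 ^ g * polarizationDegree δ))) :=
    HasRank.isFiniteLocallyFree' (hasRank_freeModule T _)
  rw [← detClass_eq_of_iso (asIso u) hfree h, detClass_freeModule_eq_one]


/-! ## §2 Classes: `𝒪(1)` vs `𝒪(-1)`, the marked sections, and the normalised isomorphism (clause (V)) in `Ȟ¹` -/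

/-- `[twistMod φ 𝒪 m] = [serreTwist φ m]⁻¹`: `𝒪_Z(m) = 𝓗om(𝒪_Z(-m), 𝒪_Z)` (★ `sheafHomTwistIso`) and `[E^∨] = [E]⁻¹` (★ `detClass_dual`).
[cite: Hartshorne1977, II Prop. 5.12 (p. 117)] [cite: Hartshorne1977, II Ex. 6.11] -/
theorem detClass_twistMod_unitModule_eq_inv {A : Type} [CommRing A] {r : ℕ} {Z : Scheme.{0}} (φ : Z ⟶ PP A r) (m : ℕ)
    (h : IsFiniteLocallyFree (twistMod φ (unitModule Z) m)) :
    detClass h = (detClass (isFiniteLocallyFree_serreTwist φ m))⁻¹ := by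
  rw [← detClass_dual (isFiniteLocallyFree_serreTwist φ m)]
  exact (detClass_eq_of_iso (sheafHomTwistIso φ (unitModule Z) m) (isFiniteLocallyFree_dual (isFiniteLocallyFree_serreTwist φ m)) h).symm

variable (P : PolarizedAbelianSchemeWithLevel g N δ T)

omit [Finite J] in
/-- **`σₐ^*[𝒪_X(1)] = [(σₐ ≫ ι)^*𝒪(-1)]⁻¹` in `Ȟ¹(T, 𝒪^×)`**: `σₐ^*𝒪_X(1) ≅ 𝒪_T(1)` along `σₐ ≫ ι` (★ `isIso_pullbackTwistHom`,
[Hartshorne1977] II Prop. 5.12 (c)) and `[𝒪(1)] = [𝒪(-1)]⁻¹`. [cite: Hartshorne1977, II Prop. 5.12 (p. 117)] [cite: Hartshorne1977, II Ex. 6.8] -/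
theorem cechPic_pullback_detClass_twistMod_one {X' : Scheme.{0}} (σ : X' ⟶ P.A.X.left) (ι : P.A.X.left ⟶ projectiveSpaceInt J)
    (h : IsFiniteLocallyFree (twistMod ι (unitModule P.A.X.left) 1)) :
    CechPic.pullback σ (detClass h) = (detClass (isFiniteLocallyFree_serreTwist (σ ≫ ι) 1))⁻¹ := by
  haveI := isIso_pullbackTwistHom σ ι 1
  rw [← detClass_pullback σ h, detClass_eq_of_iso (asIso (pullbackTwistHom σ ι 1)) (h.pullback σ)
    (HasRank.isFiniteLocallyFree' (hasRank_twistMod_unitModule (σ ≫ ι) 1)), detClass_twistMod_unitModule_eq_inv]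

/-- **CLAUSE (V) IN CLASSES: `[𝒪_X(1)] · (π^*ε^*[𝒪_X(1)])⁻¹ = [L^Δ(λ)]^3` in `Ȟ¹(X, 𝒪^×)`** for a linear rigidification `ι` of `P` over a
locally Noetherian `T` (★ R-B2a `nonempty_normalised_iso_LDelta_tensorPow_of_isLinearRigidification` at `Z₀ := X`, `pr := 𝟙`, read on
determinant classes: ★ `detClass_tensorObj_of_hasRank_one`, ★ `detClass_pullback`, ★ `detClass_dual'`, ★ `detClass_tensorPow`).
[cite: MumfordFogartyKirwan1994, Ch. 7 §2 Proposition 7.3 (pp. 132–134)] [cite: MumfordFogartyKirwan1994, Ch. 7 §2 Def. 7.5 (p. 130)] -/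
theorem IsLinearRigidification.detClass_twistMod_one_mul_inv_eq_detClass_LDelta_pow [IsLocallyNoetherian T]
    {ι : P.A.X.left ⟶ projectiveSpaceInt J} (hι : P.IsLinearRigidification J ι)
    (Gr : P.A.X.left ⟶ P.A.prodLeft P.D.hat) (hGr₁ : Gr ≫ pullback.fst P.A.X.hom P.D.hat.X.hom = 𝟙 _)
    (hGr₂ : Gr ≫ pullback.snd P.A.X.hom P.D.hat.X.hom = P.pol.lam.left)
    (hM : IsFiniteLocallyFree (twistMod ι (unitModule P.A.X.left) 1))
    (hL : IsFiniteLocallyFree ((Scheme.Modules.pullback Gr).obj P.D.P)) :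
    detClass hM * (CechPic.pullback P.A.X.hom (CechPic.pullback P.A.unitSection (detClass hM)))⁻¹ = detClass hL ^ 3 := by
  obtain ⟨e⟩ := P.nonempty_normalised_iso_LDelta_tensorPow_of_isLinearRigidification J ι hι (𝟙 _) (Category.id_comp ι) Gr hGr₁ hGr₂
  -- ranks and witnesses (as in ★ R-B2a)
  have hL₀ : HasRank (twistMod ι (unitModule P.A.X.left) 1) 1 := hasRank_twistMod_unitModule ι 1
  have hLb : HasRank ((Scheme.Modules.pullback (𝟙 P.A.X.left)).obj (twistMod ι (unitModule P.A.X.left) 1)) 1 :=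
    hasRank_pullback _ hL₀
  have hLb' := P.A.hasRank_normalised _ hLb
  have hM1 : HasRank ((Scheme.Modules.pullback Gr).obj P.D.P) 1 := hasRank_pullback Gr P.D.hasRank_one
  have hM3 : HasRank (tensorPow ((Scheme.Modules.pullback Gr).obj P.D.P) 3) 1 := hasRank_tensorPow_one hM1 3
  have hεLb : HasRank ((Scheme.Modules.pullback P.A.unitSection).obj
      ((Scheme.Modules.pullback (𝟙 P.A.X.left)).obj (twistMod ι (unitModule P.A.X.left) 1))) 1 := hasRank_pullback _ hLb
  have hQd : HasRank (Modules.dual ((Scheme.Modules.pullback P.A.unitSection).obj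
      ((Scheme.Modules.pullback (𝟙 P.A.X.left)).obj (twistMod ι (unitModule P.A.X.left) 1)))) 1 := hasRank_dual hεLb
  have hQ : HasRank ((Scheme.Modules.pullback P.A.X.hom).obj (Modules.dual ((Scheme.Modules.pullback P.A.unitSection).obj
      ((Scheme.Modules.pullback (𝟙 P.A.X.left)).obj (twistMod ι (unitModule P.A.X.left) 1))))) 1 := hasRank_pullback _ hQd
  let fLb := HasRank.isFiniteLocallyFree' hLb
  let fLb' := HasRank.isFiniteLocallyFree' hLb'
  let fM3 := HasRank.isFiniteLocallyFree' hM3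
  let fεLb := HasRank.isFiniteLocallyFree' hεLb
  let fQd := HasRank.isFiniteLocallyFree' hQd
  let fQ := HasRank.isFiniteLocallyFree' hQ
  -- `[Lb] = [M]` (pull-back along the identity)
  have cLb : detClass fLb = detClass hM := by
    rw [detClass_congr fLb (hM.pullback (𝟙 _)), detClass_pullback, CechPic.pullback_id_apply]
  -- `[Lb′] = [Lb] · (π^* ε^* [Lb])⁻¹`
  have cLb' : detClass fLb' = detClass fLb *
      (CechPic.pullback P.A.X.hom (CechPic.pullback P.A.unitSection (detClass fLb)))⁻¹ := by
    rw [detClass_tensorObj_of_hasRank_one hLb hQ fLb fQ fLb',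
      (detClass_eq_of_iso (Iso.refl _) fQ (fQd.pullback P.A.X.hom)).trans (detClass_pullback P.A.X.hom fQd),
      detClass_dual' fεLb fQd, (detClass_eq_of_iso (Iso.refl _) fεLb (fLb.pullback P.A.unitSection)).trans
        (detClass_pullback P.A.unitSection fLb), map_inv]
  -- `[Lb′] = [L^Δ]^3`
  have c3 : detClass fLb' = detClass hL ^ 3 := by
    rw [detClass_eq_of_iso e fLb' fM3, detClass_tensorPow hM1 hL 3 fM3]
  rw [← cLb, ← cLb', c3]

/-- **The section classes from clause (V): `[(σ ≫ ι)^*𝒪(-1)]⁻¹ · [(ε ≫ ι)^*𝒪(-1)] = [σ^*L^Δ(λ)]^3` in `Ȟ¹(T, 𝒪^×)`** for any section `σ` of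
`π` (the `2g+1` marked sections `ε, σᵢ` of [MumfordFogartyKirwan1994] Ch. 7 §2 (b)) and any local-freeness witness — pull the class identity of
clause (V) back along `σ` (`σ ≫ π = 𝟙`, ★ `CechPic.pullback_comp`, ★ `CechPic.pullback_id_apply`).
[cite: MumfordFogartyKirwan1994, Ch. 7 §2 (b) and (*) (p. 131)] [cite: MumfordFogartyKirwan1994, Ch. 7 §2 Def. 7.5 (p. 130)] -/
theorem IsLinearRigidification.detClass_serreTwist_section_inv_mul [IsLocallyNoetherian T]
    {ι : P.A.X.left ⟶ projectiveSpaceInt J} (hι : P.IsLinearRigidification J ι)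
    (Gr : P.A.X.left ⟶ P.A.prodLeft P.D.hat) (hGr₁ : Gr ≫ pullback.fst P.A.X.hom P.D.hat.X.hom = 𝟙 _)
    (hGr₂ : Gr ≫ pullback.snd P.A.X.hom P.D.hat.X.hom = P.pol.lam.left) (σ : T ⟶ P.A.X.left) (hσ : σ ≫ P.A.X.hom = 𝟙 T)
    (hσL : IsFiniteLocallyFree ((Scheme.Modules.pullback σ).obj ((Scheme.Modules.pullback Gr).obj P.D.P))) :
    (detClass (isFiniteLocallyFree_serreTwist (σ ≫ ι) 1))⁻¹ * detClass (isFiniteLocallyFree_serreTwist (P.A.unitSection ≫ ι) 1) =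
      detClass hσL ^ 3 := by
  have hM : IsFiniteLocallyFree (twistMod ι (unitModule P.A.X.left) 1) :=
    HasRank.isFiniteLocallyFree' (hasRank_twistMod_unitModule ι 1)
  have hL : IsFiniteLocallyFree ((Scheme.Modules.pullback Gr).obj P.D.P) :=
    HasRank.isFiniteLocallyFree' (hasRank_pullback Gr P.D.hasRank_one)
  have h := congrArg (CechPic.pullback σ) (hι.detClass_twistMod_one_mul_inv_eq_detClass_LDelta_pow P Gr hGr₁ hGr₂ hM hL)
  rw [map_mul, map_inv, map_pow, ← CechPic.pullback_comp, hσ, CechPic.pullback_id_apply,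
    P.cechPic_pullback_detClass_twistMod_one σ ι hM, P.cechPic_pullback_detClass_twistMod_one P.A.unitSection ι hM,
    inv_inv, ← detClass_pullback σ hL, detClass_congr (hL.pullback σ) hσL] at h
  exact h


omit [Finite J] in
/-- **`[(ε^*𝒪_X(1))^∨] = [(ε ≫ ι)^*𝒪(-1)]`** (the class of the normalising twist `Q = (ε^*𝒪_X(1)′)^∨`, `′` = pulled back along `𝟙_X`):
★ `detClass_dual'`, ★ `detClass_pullback`, ★ `CechPic.pullback_id_apply`, §2. [cite: Hartshorne1977, II Ex. 6.11] [cite: Hartshorne1977, II Prop. 5.12 (p. 117)] -/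
theorem detClass_dual_unitSection_pullback_twistMod_one (ι : P.A.X.left ⟶ projectiveSpaceInt J)
    (hQ' : IsFiniteLocallyFree (Modules.dual ((Scheme.Modules.pullback P.A.unitSection).obj
      ((Scheme.Modules.pullback (𝟙 P.A.X.left)).obj (twistMod ι (unitModule P.A.X.left) 1))))) :
    detClass hQ' = detClass (isFiniteLocallyFree_serreTwist (P.A.unitSection ≫ ι) 1) := by
  have hM : IsFiniteLocallyFree (twistMod ι (unitModule P.A.X.left) 1) := HasRank.isFiniteLocallyFree' (hasRank_twistMod_unitModule ι 1)
  let fLb : IsFiniteLocallyFree ((Scheme.Modules.pullback (𝟙 P.A.X.left)).obj (twistMod ι (unitModule P.A.X.left) 1)) :=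
    hM.pullback (𝟙 P.A.X.left)
  let fεLb : IsFiniteLocallyFree ((Scheme.Modules.pullback P.A.unitSection).obj
      ((Scheme.Modules.pullback (𝟙 P.A.X.left)).obj (twistMod ι (unitModule P.A.X.left) 1))) := fLb.pullback P.A.unitSection
  rw [detClass_dual' fεLb hQ', detClass_pullback P.A.unitSection fLb, detClass_pullback (𝟙 P.A.X.left) hM, CechPic.pullback_id_apply,
    P.cechPic_pullback_detClass_twistMod_one P.A.unitSection ι hM, inv_inv]

/-! ## §3 `π_*L^{Δ3}` is locally free and `[det π_*L^{Δ3}] = ν_ε^{6^g·d}` -/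

/-- **`π_*L^Δ(λ)^{⊗3} ≅ (ε^*𝒪_X(1))^∨ ⊗ 𝒪_T^{6^g·d}` in classes: it is finite locally free and `[det π_*L^{Δ3}] = [(ε ≫ ι)^*𝒪(-1)]^{6^g·d}`.**
Clause (V) `L^{Δ3} ≅ 𝒪_X(1) ⊗ π^*(ε^*𝒪_X(1))^∨` (★ R-B2a), the projection formula `π_*(π^*Q ⊗ M) ≅ Q ⊗ π_*M` (★ `projectionFormulaIso`,
★ `tensorComm`), `π_*𝒪_X(1) ≅ 𝒪_T^{6^g·d}` (§1), `[Q ⊗ F] = [Q]^{rk F}·[F]` (★ `detClass_tensorObj`), `[𝒪_T^{(n)}] = 1`.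
[cite: MumfordFogartyKirwan1994, Ch. 7 §2 Prop. 7.3, steps (V)–(VI) of the proof (pp. 132–134)] [cite: Hartshorne1977, II Ex. 5.1 (d)] -/
theorem IsLinearRigidification.exists_detClass_pushforward_LDelta_pow_three [IsLocallyNoetherian T]
    {ι : P.A.X.left ⟶ projectiveSpaceInt J} (hι : P.IsLinearRigidification J ι) (hJ : Nat.card J + 1 = 6 ^ g * polarizationDegree δ)
    (Gr : P.A.X.left ⟶ P.A.prodLeft P.D.hat) (hGr₁ : Gr ≫ pullback.fst P.A.X.hom P.D.hat.X.hom = 𝟙 _)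
    (hGr₂ : Gr ≫ pullback.snd P.A.X.hom P.D.hat.X.hom = P.pol.lam.left) :
    ∃ h₃ : IsFiniteLocallyFree ((Scheme.Modules.pushforward P.A.X.hom).obj (tensorPow ((Scheme.Modules.pullback Gr).obj P.D.P) 3)),
      detClass h₃ = detClass (isFiniteLocallyFree_serreTwist (P.A.unitSection ≫ ι) 1) ^ (6 ^ g * polarizationDegree δ) := by
  obtain ⟨e⟩ := P.nonempty_normalised_iso_LDelta_tensorPow_of_isLinearRigidification J ι hι (𝟙 _) (Category.id_comp ι) Gr hGr₁ hGr₂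
  obtain ⟨u, hu, -⟩ := hι.exists_isIso_freeModule_hom_pushforward_twistMod_one P hJ
  haveI := hu
  -- ranks and witnesses
  have hM : IsFiniteLocallyFree (twistMod ι (unitModule P.A.X.left) 1) := HasRank.isFiniteLocallyFree' (hasRank_twistMod_unitModule ι 1)
  have hLb : HasRank ((Scheme.Modules.pullback (𝟙 P.A.X.left)).obj (twistMod ι (unitModule P.A.X.left) 1)) 1 :=
    hasRank_pullback _ (hasRank_twistMod_unitModule ι 1)
  have hεLb : HasRank ((Scheme.Modules.pullback P.A.unitSection).obj
      ((Scheme.Modules.pullback (𝟙 P.A.X.left)).obj (twistMod ι (unitModule P.A.X.left) 1))) 1 := hasRank_pullback _ hLb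
  have hQ : HasRank (Modules.dual ((Scheme.Modules.pullback P.A.unitSection).obj
      ((Scheme.Modules.pullback (𝟙 P.A.X.left)).obj (twistMod ι (unitModule P.A.X.left) 1)))) 1 := hasRank_dual hεLb
  have hfree : HasRank (freeModule T (Fin (6 ^ g * polarizationDegree δ))) (6 ^ g * polarizationDegree δ) := by
    simpa only [Fintype.card_fin] using hasRank_freeModule T (Fin (6 ^ g * polarizationDegree δ))
  let fLb := HasRank.isFiniteLocallyFree' hLb
  let fεLb := HasRank.isFiniteLocallyFree' hεLb
  let fQ := HasRank.isFiniteLocallyFree' hQ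
  let ffree := HasRank.isFiniteLocallyFree' hfree
  -- `π_*𝒪_X(1)′ ≅ 𝒪_T^{6^g·d}` (`′` = pulled back along `𝟙_X`)
  let ψ : (Scheme.Modules.pushforward P.A.X.hom).obj ((Scheme.Modules.pullback (𝟙 P.A.X.left)).obj
      (twistMod ι (unitModule P.A.X.left) 1)) ≅ freeModule T (Fin (6 ^ g * polarizationDegree δ)) :=
    (Scheme.Modules.pushforward P.A.X.hom).mapIso ((Scheme.Modules.pullbackId P.A.X.left).app _) ≪≫ (asIso u).symm
  -- the chain `π_*L^{Δ3} ≅ π_*(M′ ⊗ π^*Q) ≅ π_*(π^*Q ⊗ M′) ≅ Q ⊗ π_*M′ ≅ Q ⊗ 𝒪^{6^g·d}`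
  let Φ : (Scheme.Modules.pushforward P.A.X.hom).obj (tensorPow ((Scheme.Modules.pullback Gr).obj P.D.P) 3) ≅
      tensorObj (Modules.dual ((Scheme.Modules.pullback P.A.unitSection).obj
        ((Scheme.Modules.pullback (𝟙 P.A.X.left)).obj (twistMod ι (unitModule P.A.X.left) 1))))
        (freeModule T (Fin (6 ^ g * polarizationDegree δ))) :=
    (Scheme.Modules.pushforward P.A.X.hom).mapIso e.symm ≪≫ (Scheme.Modules.pushforward P.A.X.hom).mapIso (tensorComm _ _) ≪≫
      projectionFormulaIso P.A.X.hom fQ _ ≪≫ tensorMapIso (Iso.refl _) ψ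
  have hT : IsFiniteLocallyFree (tensorObj (Modules.dual ((Scheme.Modules.pullback P.A.unitSection).obj
        ((Scheme.Modules.pullback (𝟙 P.A.X.left)).obj (twistMod ι (unitModule P.A.X.left) 1))))
        (freeModule T (Fin (6 ^ g * polarizationDegree δ)))) := isFiniteLocallyFree_tensorObj _ _ fQ ffree
  refine ⟨isFiniteLocallyFree_of_iso Φ.symm hT, ?_⟩
  -- classes
  have cQ := P.detClass_dual_unitSection_pullback_twistMod_one ι fQ
  rw [detClass_eq_of_iso Φ _ hT, detClass_tensorObj hQ hfree fQ ffree hT, detClass_freeModule_eq_one, one_pow, mul_one, cQ]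

/-! ## §4 (c2′): the marked-section frame classes, `(m+1)`-th powers -/

/-- **(c2′) `[(σ ≫ ι)^*𝒪(-1)]^{#J+1} = [σ^*L^Δ(λ)]^{e₁} · [det π_*L^Δ(λ)^{⊗3}]^{e₂}`** with `e₁ = -3(#J+1)`, `e₂ = 1`, for ANY section `σ` of `π` and any
local-freeness witness — the U-FREE form of [MumfordFogartyKirwan1994] Prop. 7.4's marked-point classes for a linear rigidification with
`#J + 1 = 6^g·d` (§2: `ν_σ = ν_ε · [σ^*L^Δ]^{-3}`; §3: `ν_ε^{6^g·d} = [det π_*L^{Δ3}]`).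
[cite: MumfordFogartyKirwan1994, Ch. 7 §2 Proposition 7.4 (p. 135)] [cite: MumfordFogartyKirwan1994, Ch. 7 §2 Def. 7.5 (p. 130)] -/
theorem IsLinearRigidification.frameClass_section [IsLocallyNoetherian T]
    {ι : P.A.X.left ⟶ projectiveSpaceInt J} (hι : P.IsLinearRigidification J ι) (hJ : Nat.card J + 1 = 6 ^ g * polarizationDegree δ)
    (Gr : P.A.X.left ⟶ P.A.prodLeft P.D.hat) (hGr₁ : Gr ≫ pullback.fst P.A.X.hom P.D.hat.X.hom = 𝟙 _)
    (hGr₂ : Gr ≫ pullback.snd P.A.X.hom P.D.hat.X.hom = P.pol.lam.left) (σ : T ⟶ P.A.X.left) (hσ : σ ≫ P.A.X.hom = 𝟙 T)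
    (hσL : IsFiniteLocallyFree ((Scheme.Modules.pullback σ).obj ((Scheme.Modules.pullback Gr).obj P.D.P))) :
    ∃ (h₃ : IsFiniteLocallyFree ((Scheme.Modules.pushforward P.A.X.hom).obj (tensorPow ((Scheme.Modules.pullback Gr).obj P.D.P) 3)))
      (e₁ e₂ : ℤ),
      detClass (SerreTwist.isFiniteLocallyFree_serreTwist (σ ≫ ι) 1) ^ (Nat.card J + 1) = detClass hσL ^ e₁ * detClass h₃ ^ e₂ := by
  obtain ⟨h₃, hD⟩ := hι.exists_detClass_pushforward_LDelta_pow_three P hJ Gr hGr₁ hGr₂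
  have hB := hι.detClass_serreTwist_section_inv_mul P Gr hGr₁ hGr₂ σ hσ hσL
  refine ⟨h₃, -((3 * (Nat.card J + 1) : ℕ) : ℤ), 1, ?_⟩
  rw [zpow_one, hD, ← hJ, zpow_neg, zpow_natCast]
  rw [inv_mul_eq_iff_eq_mul] at hB
  rw [hB, mul_pow, ← pow_mul, mul_comm (detClass (SerreTwist.isFiniteLocallyFree_serreTwist (σ ≫ ι) 1) ^ _) _,
    inv_mul_cancel_left]


/-! ## §5 (c3′): the direct images of the positive twists `π_*𝒪_X(d)`, `(m+1)`-th powers -/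

/-- **(c3′) `[det π_*𝒪_X(d)]^{#J+1} = [det π_*L^Δ(λ)^{⊗3d}]^{e₁} · [det π_*L^Δ(λ)^{⊗3}]^{e₂}`** with `e₁ = #J+1`, `e₂ = -d·(6d)^g·d_δ`, for a linear
rigidification `ι` of `P` over a locally Noetherian `ℚ`-scheme `T` with `#J + 1 = 6^g·d_δ` and every `d > 0`; own local-freeness witnesses:
`π_*𝒪_X(d)` has rank `(6d)^g·d_δ` (★ `IsLinearRigidification.hasRank_pushforward_twistMod`, cohomology and base change), `L^{Δ3d} ≅ π^*Q^{⊗d} ⊗ 𝒪_X(d)`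
(rank-one modules with equal classes, ★ `nonempty_iso_iff_detClass_eq`; clause (V) §2, `[𝒪_X(d)] = [𝒪_X(1)]^d` ★ `detClass_serreTwist_eq_pow`), so
`π_*L^{Δ3d} ≅ Q^{⊗d} ⊗ π_*𝒪_X(d)` (★ `projectionFormulaIso`) and `[det π_*L^{Δ3d}] = [Q]^{d·(6d)^g·d_δ} · [det π_*𝒪_X(d)]`, `[Q]^{6^g·d_δ} = [det π_*L^{Δ3}]` (§3).
[cite: MumfordFogartyKirwan1994, Ch. 7 §2 Proposition 7.4 (p. 135)] [cite: MumfordFogartyKirwan1994, Ch. 6 §2 Proposition 6.13 (p. 123)]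
[cite: Hartshorne1977, II Ex. 5.1 (d)] -/
theorem IsLinearRigidification.frameClass_pushforward_twistMod [IsLocallyNoetherian T] (πT : T ⟶ Spec (.of ℚ))
    {ι : P.A.X.left ⟶ projectiveSpaceInt J} (hι : P.IsLinearRigidification J ι) (hJ : Nat.card J + 1 = 6 ^ g * polarizationDegree δ)
    (Gr : P.A.X.left ⟶ P.A.prodLeft P.D.hat) (hGr₁ : Gr ≫ pullback.fst P.A.X.hom P.D.hat.X.hom = 𝟙 _)
    (hGr₂ : Gr ≫ pullback.snd P.A.X.hom P.D.hat.X.hom = P.pol.lam.left) (d : ℕ) (hd : 0 < d) :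
    ∃ (hd' : IsFiniteLocallyFree ((Scheme.Modules.pushforward P.A.X.hom).obj (twistMod ι (unitModule P.A.X.left) d)))
      (h₃d : IsFiniteLocallyFree ((Scheme.Modules.pushforward P.A.X.hom).obj (tensorPow ((Scheme.Modules.pullback Gr).obj P.D.P) (3 * d))))
      (h₃ : IsFiniteLocallyFree ((Scheme.Modules.pushforward P.A.X.hom).obj (tensorPow ((Scheme.Modules.pullback Gr).obj P.D.P) 3)))
      (e₁ e₂ : ℤ), detClass hd' ^ (Nat.card J + 1) = detClass h₃d ^ e₁ * detClass h₃ ^ e₂ := by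
  -- §3 for `π_*L^{Δ3}` and the rank of `π_*𝒪_X(d)`
  obtain ⟨h₃, hD3⟩ := hι.exists_detClass_pushforward_LDelta_pow_three P hJ Gr hGr₁ hGr₂
  have hrk := IsLinearRigidification.hasRank_pushforward_twistMod J πT hι hd
  let hd' : IsFiniteLocallyFree ((Scheme.Modules.pushforward P.A.X.hom).obj (twistMod ι (unitModule P.A.X.left) d)) :=
    HasRank.isFiniteLocallyFree' hrk
  -- ranks and witnesses on `X` and `T`
  have hM1 : HasRank (twistMod ι (unitModule P.A.X.left) 1) 1 := hasRank_twistMod_unitModule ι 1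
  have hMd1 : HasRank (twistMod ι (unitModule P.A.X.left) d) 1 := hasRank_twistMod_unitModule ι d
  have hL1 : HasRank ((Scheme.Modules.pullback Gr).obj P.D.P) 1 := hasRank_pullback Gr P.D.hasRank_one
  have hL3d : HasRank (tensorPow ((Scheme.Modules.pullback Gr).obj P.D.P) (3 * d)) 1 := hasRank_tensorPow_one hL1 (3 * d)
  have hLb : HasRank ((Scheme.Modules.pullback (𝟙 P.A.X.left)).obj (twistMod ι (unitModule P.A.X.left) 1)) 1 :=
    hasRank_pullback _ hM1
  have hεLb : HasRank ((Scheme.Modules.pullback P.A.unitSection).obj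
      ((Scheme.Modules.pullback (𝟙 P.A.X.left)).obj (twistMod ι (unitModule P.A.X.left) 1))) 1 := hasRank_pullback _ hLb
  have hQ : HasRank (Modules.dual ((Scheme.Modules.pullback P.A.unitSection).obj
      ((Scheme.Modules.pullback (𝟙 P.A.X.left)).obj (twistMod ι (unitModule P.A.X.left) 1)))) 1 := hasRank_dual hεLb
  have hQd : HasRank (tensorPow (Modules.dual ((Scheme.Modules.pullback P.A.unitSection).obj
      ((Scheme.Modules.pullback (𝟙 P.A.X.left)).obj (twistMod ι (unitModule P.A.X.left) 1)))) d) 1 := hasRank_tensorPow_one hQ d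
  have hπQd : HasRank ((Scheme.Modules.pullback P.A.X.hom).obj (tensorPow (Modules.dual ((Scheme.Modules.pullback P.A.unitSection).obj
      ((Scheme.Modules.pullback (𝟙 P.A.X.left)).obj (twistMod ι (unitModule P.A.X.left) 1)))) d)) 1 := hasRank_pullback _ hQd
  let fM := HasRank.isFiniteLocallyFree' hM1
  let fMd := HasRank.isFiniteLocallyFree' hMd1
  let fL := HasRank.isFiniteLocallyFree' hL1
  let fL3d := HasRank.isFiniteLocallyFree' hL3d
  let fQ := HasRank.isFiniteLocallyFree' hQ
  let fQd := HasRank.isFiniteLocallyFree' hQd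
  let fπQd := HasRank.isFiniteLocallyFree' hπQd
  have hT1 : HasRank (tensorObj ((Scheme.Modules.pullback P.A.X.hom).obj (tensorPow (Modules.dual
      ((Scheme.Modules.pullback P.A.unitSection).obj ((Scheme.Modules.pullback (𝟙 P.A.X.left)).obj
        (twistMod ι (unitModule P.A.X.left) 1)))) d)) (twistMod ι (unitModule P.A.X.left) d)) 1 := hasRank_tensorObj_one hπQd hMd1
  let fT := HasRank.isFiniteLocallyFree' hT1
  -- classes on `X`: `[L]^3 = [𝒪(-1)]⁻¹ · π^*[Q]` (clause (V), §2) and `[𝒪_X(d)] = ([𝒪(-1)]^d)⁻¹`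
  have cQ := P.detClass_dual_unitSection_pullback_twistMod_one ι fQ
  have cV := hι.detClass_twistMod_one_mul_inv_eq_detClass_LDelta_pow P Gr hGr₁ hGr₂ fM fL
  rw [P.cechPic_pullback_detClass_twistMod_one P.A.unitSection ι fM, map_inv, inv_inv, detClass_twistMod_unitModule_eq_inv ι 1 fM] at cV
  -- the rank-one modules `π^*Q^{⊗d} ⊗ 𝒪_X(d)` and `L^{Δ3d}` have the same class, hence are isomorphic
  have hcl : detClass fT = detClass fL3d := by
    rw [detClass_tensorObj_of_hasRank_one hπQd hMd1 fπQd fMd fT, detClass_congr fπQd (fQd.pullback P.A.X.hom),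
      detClass_pullback P.A.X.hom fQd, detClass_tensorPow hQ fQ d fQd, cQ, detClass_twistMod_unitModule_eq_inv ι d fMd,
      detClass_serreTwist_eq_pow ι d, detClass_tensorPow hL1 fL (3 * d) fL3d, pow_mul, ← cV, mul_pow, map_pow, inv_pow, mul_comm]
  obtain ⟨κ⟩ := (nonempty_iso_iff_detClass_eq hT1 hL3d fT fL3d).2 hcl
  -- `π_*L^{Δ3d} ≅ Q^{⊗d} ⊗ π_*𝒪_X(d)` (projection formula)
  let Φ : (Scheme.Modules.pushforward P.A.X.hom).obj (tensorPow ((Scheme.Modules.pullback Gr).obj P.D.P) (3 * d)) ≅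
      tensorObj (tensorPow (Modules.dual ((Scheme.Modules.pullback P.A.unitSection).obj
        ((Scheme.Modules.pullback (𝟙 P.A.X.left)).obj (twistMod ι (unitModule P.A.X.left) 1)))) d)
        ((Scheme.Modules.pushforward P.A.X.hom).obj (twistMod ι (unitModule P.A.X.left) d)) :=
    (Scheme.Modules.pushforward P.A.X.hom).mapIso κ.symm ≪≫ projectionFormulaIso P.A.X.hom fQd _
  have hTd : IsFiniteLocallyFree (tensorObj (tensorPow (Modules.dual ((Scheme.Modules.pullback P.A.unitSection).obj
        ((Scheme.Modules.pullback (𝟙 P.A.X.left)).obj (twistMod ι (unitModule P.A.X.left) 1)))) d)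
        ((Scheme.Modules.pushforward P.A.X.hom).obj (twistMod ι (unitModule P.A.X.left) d))) := isFiniteLocallyFree_tensorObj _ _ fQd hd'
  let h₃d : IsFiniteLocallyFree ((Scheme.Modules.pushforward P.A.X.hom).obj (tensorPow ((Scheme.Modules.pullback Gr).obj P.D.P) (3 * d))) :=
    isFiniteLocallyFree_of_iso Φ.symm hTd
  -- `[det π_*L^{Δ3d}] = [Q]^{d·r_d} · [det π_*𝒪_X(d)]`
  have hD3d : detClass h₃d = (detClass (isFiniteLocallyFree_serreTwist (P.A.unitSection ≫ ι) 1) ^ d) ^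
      ((6 * d) ^ g * polarizationDegree δ) * detClass hd' := by
    rw [detClass_eq_of_iso Φ h₃d hTd, detClass_tensorObj hQd hrk fQd hd' hTd, pow_one, detClass_tensorPow hQ fQ d fQd, cQ]
  refine ⟨hd', h₃d, h₃, ((Nat.card J + 1 : ℕ) : ℤ), -((d * ((6 * d) ^ g * polarizationDegree δ) : ℕ) : ℤ), ?_⟩
  set ν := detClass (isFiniteLocallyFree_serreTwist (P.A.unitSection ≫ ι) 1) with hν
  rw [zpow_natCast, zpow_neg, zpow_natCast, hD3, hD3d, ← hJ, mul_pow, ← pow_mul, ← pow_mul, ← pow_mul,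
    show d * ((6 * d) ^ g * polarizationDegree δ * (Nat.card J + 1)) = (Nat.card J + 1) * (d * ((6 * d) ^ g * polarizationDegree δ)) by ring,
    mul_comm (ν ^ _) (detClass hd' ^ _), mul_assoc, mul_inv_cancel, mul_one]


/-! ## §6 HEAD — the letter of `stub_PLunitCocycle` (F-13 skeleton v0, shape (β′)) with the marked sections as ANY sections of `π` -/

/-- **THE FRAME CLASSES OF A LINEAR RIGIDIFICATION, `[U]`-FREE** — the letter of the F-13 stub `stub_PLunitCocycle` ([MumfordFogartyKirwan1994]
Def. 7.5 / Prop. 7.6 / Prop. 7.4, in the `(m+1)`-th-power form that eliminates the unit cocycle `[U]`), with the `2g+1` marked sections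
`P.markedSection a` of (M2b) ED. 2 replaced by an arbitrary section `σ` of `π` and its pulled-back local-freeness witness (the stub follows at
`σ := P.markedSection a`, `hσL := P.isFiniteLocallyFree_markedSectionPullback_LDelta Gr a`): for a triple `P` over a locally Noetherian
`ℚ`-scheme `T`, a linear rigidification `ι : X → 𝐏^J_ℤ` with `#J + 1 = 6^g·d_δ` and the graph datum `Gr`: (c2′) `[(σ ≫ ι)^*𝒪(-1)]^{#J+1} =
[σ^*L^Δ(λ)]^{e₁} · [det π_*L^Δ(λ)^{⊗3}]^{e₂}` for some integers (§4); (c3′) for every `d > 0`, `π_*𝒪_X(d)` is finite locally free and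
`[det π_*𝒪_X(d)]^{#J+1} = [det π_*L^{Δ3d}]^{e₁} · [det π_*L^{Δ3}]^{e₂}` (§5).  ROAD: clause (V) of Prop. 7.3 (★ R-B2a, rigidified gluing) + step (VI)
«`π_*𝒪_X(1)` is free on the coordinate sections» (§1) + the projection formula + cohomology-and-base-change ranks — no explicit cocycle.
[cite: MumfordFogartyKirwan1994, Ch. 7 §2 Definition 7.5 (p. 130), Proposition 7.6 (p. 136), Proposition 7.4 (p. 135); Ch. 6 §2 Proposition 6.13 (p. 123)] -/
theorem IsLinearRigidification.frameClasses : ∀ ⦃g N : ℕ⦄ ⦃δ : Fin g → ℕ⦄ ⦃J : Type⦄ [Finite J] ⦃T : Scheme.{0}⦄ [IsLocallyNoetherian T]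
    (_πT : T ⟶ Spec (.of ℚ)) (P : PolarizedAbelianSchemeWithLevel g N δ T) (ι : P.A.X.left ⟶ projectiveSpaceInt J),
    P.IsLinearRigidification J ι → Nat.card J + 1 = 6 ^ g * polarizationDegree δ →
    ∀ (Gr : P.A.X.left ⟶ P.A.prodLeft P.D.hat) (_ : Gr ≫ pullback.fst P.A.X.hom P.D.hat.X.hom = 𝟙 _)
      (_ : Gr ≫ pullback.snd P.A.X.hom P.D.hat.X.hom = P.pol.lam.left),
    (∀ (σ : T ⟶ P.A.X.left), σ ≫ P.A.X.hom = 𝟙 T →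
      ∀ hσL : IsFiniteLocallyFree ((Scheme.Modules.pullback σ).obj ((Scheme.Modules.pullback Gr).obj P.D.P)),
      ∃ (h₃ : IsFiniteLocallyFree ((Scheme.Modules.pushforward P.A.X.hom).obj (tensorPow ((Scheme.Modules.pullback Gr).obj P.D.P) 3)))
        (e₁ e₂ : ℤ),
        detClass (SerreTwist.isFiniteLocallyFree_serreTwist (σ ≫ ι) 1) ^ (Nat.card J + 1) = detClass hσL ^ e₁ * detClass h₃ ^ e₂) ∧
    (∀ (d : ℕ), 0 < d →
      ∃ (hd : IsFiniteLocallyFree ((Scheme.Modules.pushforward P.A.X.hom).obj (SerreTwist.twistMod ι (unitModule P.A.X.left) d)))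
        (h₃d : IsFiniteLocallyFree ((Scheme.Modules.pushforward P.A.X.hom).obj (tensorPow ((Scheme.Modules.pullback Gr).obj P.D.P) (3 * d))))
        (h₃ : IsFiniteLocallyFree ((Scheme.Modules.pushforward P.A.X.hom).obj (tensorPow ((Scheme.Modules.pullback Gr).obj P.D.P) 3)))
        (e₁ e₂ : ℤ),
        detClass hd ^ (Nat.card J + 1) = detClass h₃d ^ e₁ * detClass h₃ ^ e₂) := by
  intro g N δ J _ T _ πT P ι hι hJ Gr hGr₁ hGr₂
  exact ⟨fun σ hσ hσL => hι.frameClass_section P hJ Gr hGr₁ hGr₂ σ hσ hσL,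
    fun d hd => hι.frameClass_pushforward_twistMod P πT hJ Gr hGr₁ hGr₂ d hd⟩

end PolarizedAbelianSchemeWithLevel

end Literature.AlgebraicGeometry.AbelianSchemes

end
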